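import Literature.Combinatorics.Sahi2008.Indicators
import Mathlib.Tactic.Linarith
import Mathlib.Tactic.Ring
import Mathlib.Tactic.Positivity
import HarnessLib
import HarnessLib.Audit

/-!
# `NoHeavyLowerTail` (crux stmt-CriticalPhenomena-4575), Sahi programme P4 (Holley / monotone coupling):
# FKG slot-locality over an ARBITRARY pattern — Sahi's `E₃ ≥ 0` from a "ρ-certificate" on the pattern measure

Support file (cell `prim-l12`, seat P4, generation 6; `--supports stmt-CriticalPhenomena-4575`).  No named facts, no sorries; standard
axioms; def-free.

This is the pattern-independent half of the programme "Sahi's `C₃` for `(↑j₁ ∪ … ∪ ↑j_k, A, B)` under every FKG measure" (HOME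
prim-l12-p4/RHO-LEMMA-gen6.md), generalising steps (1)–(3) of `…SahiE3TwoPrimeSlotQuad/Ineq` from the pattern `2²` to an arbitrary
finite pattern `P` with a bottom `⊥` (in the application: the image of `x ↦ (j_i ≤ x)_i`, fibre masses `ν`, fibre densities `α, β, γ` of
`A, B, A ∩ B`).  Sahi's functional `Z³·E₃(1_U, 1_A, 1_B)`, `U = ` all fibres but `⊥`, is the cubic displayed in `phi_nonneg_of_certificate`.

THEOREM `phi_nonneg_of_certificate`.  Let `ν ≥ 0`; `α, β` monotone with `α ⊥, β ⊥ ≥ 0`; `γ t ≥ max(γ ⊥, α t β t)` for `t ≠ ⊥` (all consequences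
of the four functions theorem in the application).  Suppose a CERTIFICATE `T : P → ℝ` is given with, for `t ≠ ⊥` and up-sets `S, S' ∌ ⊥`
(`Z = Σ ν`, `u = Σ_{t≠⊥} ν`):
  (T0) `0 ≤ T t`, (T1) `T t ≤ Z ν_t (Z + ν_⊥)`, (TΣ) `Σ_{t≠⊥} T t = Z ν_⊥ u`,
  (Ti) `Σ_{t∈S} T t ≤ Z ν_⊥ ν(S)`,  (Tii) `Σ_{t∈S∩S'} T t ≤ (Z + ν_⊥)(Z ν(S∩S') − ν(S)ν(S'))`.
Then `Z³E₃ ≥ 0`.  (With `σ := T/(Zν_⊥)` these are exactly the conditions (a)–(d) of the "ρ-lemma" of the HOME memo; for the pattern `2²`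
the certificate is `T = Zν₀(ν₁+E₁, ν₂+E₂, ν₃−E₁−E₂)` of `…TwoPrimeSlotIneq.exists_shift`; for general patterns its existence for every
FKG pattern measure is the open "stuck-push" conjecture, verified numerically on `2³, 2⁴, 2⁵`.)

PROOF.  (1) The coefficient of `γ t` (`t ≠ ⊥`) is `Zν_t(Z+ν_⊥) = (Zν_t(Z+ν_⊥) − T t) + T t`; bound `γ t` below by `α tβ t` against the first
part and by `γ ⊥` against the second — the `γ ⊥` terms cancel by (TΣ).  (2) In the increments `x = α − α ⊥`, `y = β − β ⊥` what is left is
`B(x,y) + α_⊥[Zν_⊥ Σνy − ΣTy] + β_⊥[Zν_⊥ Σνx − ΣTx]` with the bilinear form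
`B(f,g) = (Z+ν_⊥)(Z Σ ν f g − (Σ ν f)(Σ ν g)) − Σ T f g` (sums over `t ≠ ⊥`).  (3) `B ≥ 0` on pairs of nonnegative monotone functions
vanishing at `⊥` and the brackets are `≥ 0`: layer cake (`Literature…exists_upperSet_decomposition`) reduces to indicators of up-sets
`S ∌ ⊥`, where they are (Tii) and (Ti).
-/

namespace Summit.CriticalPhenomena.PercolationContinuityZ3.Theorems.SahiE3SlotCertificate

open Finset Literature.Combinatorics.Sahi2008
open scoped BigOperators

variable {P : Type*} [Fintype P] [DecidableEq P] [PartialOrder P] [OrderBot P]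

/-! ### The bilinear form `B(f,g)` on functions vanishing at `⊥`: linearity and symmetry -/

/-- Additivity of `B(·, g)` (written out; `B(f,g) = (Z+ν⊥)(Z Σνfg − (Σνf)(Σνg)) − ΣTfg`, sums over `t ≠ ⊥`). [this work] -/
theorem bform_add_left (ν T f₁ f₂ g : P → ℝ) (Z c : ℝ) :
    c * (Z * ∑ t ∈ univ.erase ⊥, ν t * ((f₁ + f₂) t * g t) - (∑ t ∈ univ.erase ⊥, ν t * (f₁ + f₂) t) * ∑ t ∈ univ.erase ⊥, ν t * g t)
        - ∑ t ∈ univ.erase ⊥, T t * ((f₁ + f₂) t * g t) =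
      (c * (Z * ∑ t ∈ univ.erase ⊥, ν t * (f₁ t * g t) - (∑ t ∈ univ.erase ⊥, ν t * f₁ t) * ∑ t ∈ univ.erase ⊥, ν t * g t)
        - ∑ t ∈ univ.erase ⊥, T t * (f₁ t * g t))
      + (c * (Z * ∑ t ∈ univ.erase ⊥, ν t * (f₂ t * g t) - (∑ t ∈ univ.erase ⊥, ν t * f₂ t) * ∑ t ∈ univ.erase ⊥, ν t * g t)
        - ∑ t ∈ univ.erase ⊥, T t * (f₂ t * g t)) := by
  have h1 : ∑ t ∈ univ.erase ⊥, ν t * ((f₁ + f₂) t * g t) =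
      ∑ t ∈ univ.erase ⊥, ν t * (f₁ t * g t) + ∑ t ∈ univ.erase ⊥, ν t * (f₂ t * g t) := by
    rw [← Finset.sum_add_distrib]; exact Finset.sum_congr rfl fun t _ => by simp only [Pi.add_apply]; ring
  have h2 : ∑ t ∈ univ.erase ⊥, ν t * (f₁ + f₂) t = ∑ t ∈ univ.erase ⊥, ν t * f₁ t + ∑ t ∈ univ.erase ⊥, ν t * f₂ t := by
    rw [← Finset.sum_add_distrib]; exact Finset.sum_congr rfl fun t _ => by simp only [Pi.add_apply]; ring
  have h3 : ∑ t ∈ univ.erase ⊥, T t * ((f₁ + f₂) t * g t) =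
      ∑ t ∈ univ.erase ⊥, T t * (f₁ t * g t) + ∑ t ∈ univ.erase ⊥, T t * (f₂ t * g t) := by
    rw [← Finset.sum_add_distrib]; exact Finset.sum_congr rfl fun t _ => by simp only [Pi.add_apply]; ring
  rw [h1, h2, h3]; ring

/-- Homogeneity of `B(·, g)`. [this work] -/
theorem bform_smul_left (ν T f g : P → ℝ) (Z c a : ℝ) :
    c * (Z * ∑ t ∈ univ.erase ⊥, ν t * ((a • f) t * g t) - (∑ t ∈ univ.erase ⊥, ν t * (a • f) t) * ∑ t ∈ univ.erase ⊥, ν t * g t)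
        - ∑ t ∈ univ.erase ⊥, T t * ((a • f) t * g t) =
      a * (c * (Z * ∑ t ∈ univ.erase ⊥, ν t * (f t * g t) - (∑ t ∈ univ.erase ⊥, ν t * f t) * ∑ t ∈ univ.erase ⊥, ν t * g t)
        - ∑ t ∈ univ.erase ⊥, T t * (f t * g t)) := by
  have h1 : ∑ t ∈ univ.erase ⊥, ν t * ((a • f) t * g t) = a * ∑ t ∈ univ.erase ⊥, ν t * (f t * g t) := by
    rw [Finset.mul_sum]; exact Finset.sum_congr rfl fun t _ => by simp only [Pi.smul_apply, smul_eq_mul]; ring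
  have h2 : ∑ t ∈ univ.erase ⊥, ν t * (a • f) t = a * ∑ t ∈ univ.erase ⊥, ν t * f t := by
    rw [Finset.mul_sum]; exact Finset.sum_congr rfl fun t _ => by simp only [Pi.smul_apply, smul_eq_mul]; ring
  have h3 : ∑ t ∈ univ.erase ⊥, T t * ((a • f) t * g t) = a * ∑ t ∈ univ.erase ⊥, T t * (f t * g t) := by
    rw [Finset.mul_sum]; exact Finset.sum_congr rfl fun t _ => by simp only [Pi.smul_apply, smul_eq_mul]; ring
  rw [h1, h2, h3]; ring

/-- Symmetry of `B`. [this work] -/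
theorem bform_comm (ν T f g : P → ℝ) (Z c : ℝ) :
    c * (Z * ∑ t ∈ univ.erase ⊥, ν t * (f t * g t) - (∑ t ∈ univ.erase ⊥, ν t * f t) * ∑ t ∈ univ.erase ⊥, ν t * g t)
        - ∑ t ∈ univ.erase ⊥, T t * (f t * g t) =
      c * (Z * ∑ t ∈ univ.erase ⊥, ν t * (g t * f t) - (∑ t ∈ univ.erase ⊥, ν t * g t) * ∑ t ∈ univ.erase ⊥, ν t * f t)
        - ∑ t ∈ univ.erase ⊥, T t * (g t * f t) := by
  have h1 : ∑ t ∈ univ.erase ⊥, ν t * (f t * g t) = ∑ t ∈ univ.erase ⊥, ν t * (g t * f t) :=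
    Finset.sum_congr rfl fun t _ => by ring
  have h3 : ∑ t ∈ univ.erase ⊥, T t * (f t * g t) = ∑ t ∈ univ.erase ⊥, T t * (g t * f t) :=
    Finset.sum_congr rfl fun t _ => by ring
  rw [h1, h3]; ring

/-- `B` over a layer-cake list sum in the first argument. [this work] -/
theorem bform_listSum_left (ν T g : P → ℝ) (Z c : ℝ) (l : List (ℝ × Finset P)) :
    c * (Z * ∑ t ∈ univ.erase ⊥, ν t * ((l.map fun p => p.1 • setInd p.2).sum t * g t)
          - (∑ t ∈ univ.erase ⊥, ν t * (l.map fun p => p.1 • setInd p.2).sum t) * ∑ t ∈ univ.erase ⊥, ν t * g t)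
        - ∑ t ∈ univ.erase ⊥, T t * ((l.map fun p => p.1 • setInd p.2).sum t * g t) =
      (l.map fun p => p.1 * (c * (Z * ∑ t ∈ univ.erase ⊥, ν t * (setInd p.2 t * g t)
          - (∑ t ∈ univ.erase ⊥, ν t * setInd p.2 t) * ∑ t ∈ univ.erase ⊥, ν t * g t)
        - ∑ t ∈ univ.erase ⊥, T t * (setInd p.2 t * g t))).sum := by
  induction l with
  | nil => simp
  | cons p l ih =>
    rw [List.map_cons, List.sum_cons, List.map_cons, List.sum_cons, bform_add_left, bform_smul_left, ih]

/-- `B(1_S, 1_{S'})` in terms of masses, for `S ∌ ⊥`, `S' ∌ ⊥`. [this work] -/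
theorem bform_setInd (ν T : P → ℝ) (Z c : ℝ) {S S' : Finset P} (hS : ⊥ ∉ S) (hS' : ⊥ ∉ S') :
    c * (Z * ∑ t ∈ univ.erase ⊥, ν t * (setInd S t * setInd S' t) - (∑ t ∈ univ.erase ⊥, ν t * setInd S t) * ∑ t ∈ univ.erase ⊥, ν t * setInd S' t)
        - ∑ t ∈ univ.erase ⊥, T t * (setInd S t * setInd S' t) =
      c * (Z * ∑ t ∈ S ∩ S', ν t - (∑ t ∈ S, ν t) * ∑ t ∈ S', ν t) - ∑ t ∈ S ∩ S', T t := by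
  have key : ∀ (w : P → ℝ) (X : Finset P), ⊥ ∉ X → ∑ t ∈ univ.erase ⊥, w t * setInd X t = ∑ t ∈ X, w t := by
    intro w X hX
    have e : ∀ t ∈ univ.erase (⊥ : P), w t * setInd X t = if t ∈ X then w t else 0 := by
      intro t _; rw [setInd_apply]; split_ifs <;> simp
    rw [Finset.sum_congr rfl e, Finset.sum_ite_mem]
    congr 1; ext t; simp only [Finset.mem_inter, Finset.mem_erase, Finset.mem_univ, and_true, and_iff_right_iff_imp]
    intro ht h; exact hX (h ▸ ht)
  have key2 : ∀ (w : P → ℝ), ∑ t ∈ univ.erase ⊥, w t * (setInd S t * setInd S' t) = ∑ t ∈ S ∩ S', w t := by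
    intro w
    have e : ∀ t, setInd S t * setInd S' t = setInd (S ∩ S') t := fun t => by
      rw [← setInd_mul]; rfl
    simp_rw [e]
    exact key w (S ∩ S') (fun h => hS (Finset.mem_inter.1 h).1)
  rw [key2 ν, key2 T, key ν S hS, key ν S' hS']

/-! ### Layer-cake lists: evaluation facts -/

omit [Fintype P] [PartialOrder P] [OrderBot P] in
/-- A layer-cake list sum with nonnegative coefficients is pointwise nonnegative. [folklore] -/
theorem listSum_apply_nonneg (l : List (ℝ × Finset P)) (hl : ∀ p ∈ l, 0 ≤ p.1) (t : P) :
    0 ≤ (l.map fun p => p.1 • setInd p.2).sum t := by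
  induction l with
  | nil => simp
  | cons q l ih =>
    rw [List.map_cons, List.sum_cons, Pi.add_apply, Pi.smul_apply, smul_eq_mul]
    exact add_nonneg (mul_nonneg (hl q List.mem_cons_self) (setInd_nonneg _ _))
      (ih fun p hp => hl p (List.mem_cons_of_mem _ hp))

omit [Fintype P] [PartialOrder P] [OrderBot P] in
/-- A term `(c, S)` of a layer-cake list with `t ∈ S` contributes at least `c` at `t`. [folklore] -/
theorem coeff_le_listSum_apply (l : List (ℝ × Finset P)) (hl : ∀ p ∈ l, 0 ≤ p.1) {p : ℝ × Finset P} (hp : p ∈ l) {t : P}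
    (ht : t ∈ p.2) : p.1 ≤ (l.map fun p => p.1 • setInd p.2).sum t := by
  induction l with
  | nil => exact absurd hp List.not_mem_nil
  | cons q l ih =>
    rw [List.map_cons, List.sum_cons, Pi.add_apply, Pi.smul_apply, smul_eq_mul, setInd_apply]
    have hl' : ∀ p ∈ l, 0 ≤ p.1 := fun p hp => hl p (List.mem_cons_of_mem _ hp)
    have hrest := listSum_apply_nonneg l hl' t
    rcases List.mem_cons.1 hp with rfl | hp
    · rw [if_pos ht, mul_one]; linarith
    · have hq0 : 0 ≤ q.1 * (if t ∈ q.2 then (1:ℝ) else 0) := mul_nonneg (hl q List.mem_cons_self) (by split_ifs <;> norm_num)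
      linarith [ih hl' hp]

omit [Fintype P] in
/-- In a layer cake of a function vanishing at `⊥`, every term either has coefficient `0` or avoids `⊥`. [this work] -/
theorem coeff_zero_or_bot_notMem {l : List (ℝ × Finset P)} (hl : ∀ p ∈ l, 0 ≤ p.1) {f : P → ℝ}
    (hf : f = (l.map fun p => p.1 • setInd p.2).sum) (hf0 : f ⊥ = 0) {p : ℝ × Finset P} (hp : p ∈ l) : p.1 = 0 ∨ ⊥ ∉ p.2 := by
  by_cases h1 : p.1 = 0
  · exact Or.inl h1
  · right
    intro hb
    have hle := coeff_le_listSum_apply l hl hp hb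
    rw [← hf, hf0] at hle
    exact h1 (le_antisymm hle (hl p hp))

/-- `Σ_{t≠⊥} w·(layer cake)` is the list sum of `c_i · Σ_{t≠⊥} w·1_{S_i}`. [folklore] -/
theorem sum_mul_listSum (w : P → ℝ) (l : List (ℝ × Finset P)) :
    ∑ t ∈ univ.erase ⊥, w t * (l.map fun p => p.1 • setInd p.2).sum t =
      (l.map fun p => p.1 * ∑ t ∈ univ.erase ⊥, w t * setInd p.2 t).sum := by
  induction l with
  | nil => simp
  | cons p l ih =>
    rw [List.map_cons, List.sum_cons, List.map_cons, List.sum_cons, ← ih, Finset.mul_sum, ← Finset.sum_add_distrib]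
    exact Finset.sum_congr rfl fun t _ => by simp only [Pi.add_apply, Pi.smul_apply, smul_eq_mul]; ring

/-- `Σ_{t≠⊥} w·1_X = Σ_{t∈X} w` for `⊥ ∉ X`. [folklore] -/
theorem sum_mul_setInd {w : P → ℝ} {X : Finset P} (hX : ⊥ ∉ X) : ∑ t ∈ univ.erase ⊥, w t * setInd X t = ∑ t ∈ X, w t := by
  have e : ∀ t ∈ univ.erase (⊥ : P), w t * setInd X t = if t ∈ X then w t else 0 := by
    intro t _; rw [setInd_apply]; split_ifs <;> simp
  rw [Finset.sum_congr rfl e, Finset.sum_ite_mem]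
  congr 1; ext t; simp only [Finset.mem_inter, Finset.mem_erase, Finset.mem_univ, and_true, and_iff_right_iff_imp]
  intro ht h; exact hX (h ▸ ht)

/-! ### Positivity of `B` and of the linear form on the cone, from (Tii) and (Ti) -/

/-- **`B(x,y) ≥ 0`** for nonnegative monotone `x, y` vanishing at `⊥`, when `B(1_S,1_{S'}) ≥ 0` for all up-sets `S, S' ∌ ⊥`. [this work] -/
theorem bform_nonneg {ν T : P → ℝ} {Z c : ℝ}
    (hTii : ∀ S S' : Finset P, IsUpperSet (S : Set P) → IsUpperSet (S' : Set P) → ⊥ ∉ S → ⊥ ∉ S' →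
      ∑ t ∈ S ∩ S', T t ≤ c * (Z * ∑ t ∈ S ∩ S', ν t - (∑ t ∈ S, ν t) * ∑ t ∈ S', ν t))
    {x y : P → ℝ} (hx0 : ∀ t, 0 ≤ x t) (hxm : Monotone x) (hxb : x ⊥ = 0) (hy0 : ∀ t, 0 ≤ y t) (hym : Monotone y)
    (hyb : y ⊥ = 0) :
    0 ≤ c * (Z * ∑ t ∈ univ.erase ⊥, ν t * (x t * y t) - (∑ t ∈ univ.erase ⊥, ν t * x t) * ∑ t ∈ univ.erase ⊥, ν t * y t)
      - ∑ t ∈ univ.erase ⊥, T t * (x t * y t) := by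
  obtain ⟨lx, hlx, hxl⟩ := exists_upperSet_decomposition x hx0 hxm
  obtain ⟨ly, hly, hyl⟩ := exists_upperSet_decomposition y hy0 hym
  have vx := fun p (hp : p ∈ lx) => coeff_zero_or_bot_notMem (fun q hq => (hlx q hq).1) hxl hxb hp
  have vy := fun p (hp : p ∈ ly) => coeff_zero_or_bot_notMem (fun q hq => (hly q hq).1) hyl hyb hp
  rw [hxl, bform_listSum_left]
  refine List.sum_nonneg fun a ha => ?_
  obtain ⟨p, hp, rfl⟩ := List.mem_map.1 ha
  rcases vx p hp with h0 | hpb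
  · rw [h0, zero_mul]
  refine mul_nonneg (hlx p hp).1 ?_
  rw [bform_comm, hyl, bform_listSum_left]
  refine List.sum_nonneg fun b hb => ?_
  obtain ⟨q, hq, rfl⟩ := List.mem_map.1 hb
  rcases vy q hq with h0 | hqb
  · rw [h0, zero_mul]
  refine mul_nonneg (hly q hq).1 ?_
  rw [bform_setInd ν T Z c hqb hpb]
  have := hTii q.2 p.2 (hly q hq).2 (hlx p hp).2 hqb hpb
  linarith

/-- **`Σ_{t≠⊥} T x ≤ c Σ_{t≠⊥} ν x`** for nonnegative monotone `x` vanishing at `⊥`, when it holds on indicators of up-sets `S ∌ ⊥`.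
[this work] -/
theorem lform_le {ν T : P → ℝ} {c : ℝ}
    (hTi : ∀ S : Finset P, IsUpperSet (S : Set P) → ⊥ ∉ S → ∑ t ∈ S, T t ≤ c * ∑ t ∈ S, ν t)
    {x : P → ℝ} (hx0 : ∀ t, 0 ≤ x t) (hxm : Monotone x) (hxb : x ⊥ = 0) :
    ∑ t ∈ univ.erase ⊥, T t * x t ≤ c * ∑ t ∈ univ.erase ⊥, ν t * x t := by
  obtain ⟨lx, hlx, hxl⟩ := exists_upperSet_decomposition x hx0 hxm
  have vx := fun p (hp : p ∈ lx) => coeff_zero_or_bot_notMem (fun q hq => (hlx q hq).1) hxl hxb hp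
  rw [hxl, sum_mul_listSum, sum_mul_listSum]
  have hmul : ∀ l : List (ℝ × Finset P),
      c * (l.map fun p => p.1 * ∑ t ∈ univ.erase ⊥, ν t * setInd p.2 t).sum =
        (l.map fun p => c * (p.1 * ∑ t ∈ univ.erase ⊥, ν t * setInd p.2 t)).sum := by
    intro l
    induction l with
    | nil => simp
    | cons p l ih => rw [List.map_cons, List.sum_cons, List.map_cons, List.sum_cons, mul_add, ih]
  rw [hmul]
  refine List.sum_le_sum fun p hp => ?_
  rcases vx p hp with h0 | hpb
  · rw [h0]; simp
  rw [sum_mul_setInd hpb, sum_mul_setInd hpb, ← mul_assoc, mul_comm c p.1, mul_assoc]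
  exact mul_le_mul_of_nonneg_left (hTi p.2 (hlx p hp).2 hpb) (hlx p hp).1

/-! ### The theorem -/

/-- **Sahi's `Z³E₃(1_U, 1_A, 1_B) ≥ 0` from a ρ-certificate on the pattern.**  Data over a finite pattern `P` with bottom `⊥`: fibre masses
`ν ≥ 0`, densities `α, β` (monotone, nonnegative at `⊥`) and `γ` with `γ t ≥ γ ⊥`, `γ t ≥ α t β t` for `t ≠ ⊥`; a certificate `T` with
(T0) `T ≥ 0`, (T1) `T t ≤ Zν_t(Z+ν_⊥)`, (TΣ) `Σ_{t≠⊥} T = Zν_⊥·Σ_{t≠⊥}ν`, (Ti) `Σ_S T ≤ Zν_⊥ ν(S)` and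
(Tii) `Σ_{S∩S'} T ≤ (Z+ν_⊥)(Zν(S∩S') − ν(S)ν(S'))` for up-sets `S, S' ∌ ⊥` (`Z = Σν`).  Then the displayed cubic — Sahi's functional for
the triple (all fibres but `⊥`, `A`, `B`) written in fibre data — is nonnegative. [this work] -/
theorem phi_nonneg_of_certificate (ν α β γ T : P → ℝ) (hν : ∀ t, 0 ≤ ν t)
    (hα0 : 0 ≤ α ⊥) (hα : Monotone α) (hβ0 : 0 ≤ β ⊥) (hβ : Monotone β)
    (hγ0 : ∀ t, t ≠ ⊥ → γ ⊥ ≤ γ t) (hγf : ∀ t, t ≠ ⊥ → α t * β t ≤ γ t)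
    (hT0 : ∀ t, t ≠ ⊥ → 0 ≤ T t) (hT1 : ∀ t, t ≠ ⊥ → T t ≤ (∑ s, ν s) * ν t * ((∑ s, ν s) + ν ⊥))
    (hTsum : ∑ t ∈ univ.erase ⊥, T t = (∑ s, ν s) * ν ⊥ * ∑ t ∈ univ.erase ⊥, ν t)
    (hTi : ∀ S : Finset P, IsUpperSet (S : Set P) → ⊥ ∉ S → ∑ t ∈ S, T t ≤ (∑ s, ν s) * ν ⊥ * ∑ t ∈ S, ν t)
    (hTii : ∀ S S' : Finset P, IsUpperSet (S : Set P) → IsUpperSet (S' : Set P) → ⊥ ∉ S → ⊥ ∉ S' →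
      ∑ t ∈ S ∩ S', T t ≤ ((∑ s, ν s) + ν ⊥) * ((∑ s, ν s) * ∑ t ∈ S ∩ S', ν t - (∑ t ∈ S, ν t) * ∑ t ∈ S', ν t)) :
    0 ≤ 2 * (∑ t, ν t) ^ 2 * (∑ t ∈ univ.erase ⊥, ν t * γ t)
        + (∑ t ∈ univ.erase ⊥, ν t) * (∑ t, ν t * α t) * (∑ t, ν t * β t)
        - (∑ t, ν t) * ((∑ t ∈ univ.erase ⊥, ν t) * (∑ t, ν t * γ t) + (∑ t, ν t * α t) * (∑ t ∈ univ.erase ⊥, ν t * β t)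
            + (∑ t, ν t * β t) * (∑ t ∈ univ.erase ⊥, ν t * α t)) := by
  -- split the full sums at `⊥`
  have sA : ∑ t, ν t * α t = ν ⊥ * α ⊥ + ∑ t ∈ univ.erase ⊥, ν t * α t :=
    (Finset.add_sum_erase _ (fun t => ν t * α t) (Finset.mem_univ _)).symm
  have sB : ∑ t, ν t * β t = ν ⊥ * β ⊥ + ∑ t ∈ univ.erase ⊥, ν t * β t :=
    (Finset.add_sum_erase _ (fun t => ν t * β t) (Finset.mem_univ _)).symm
  have sC : ∑ t, ν t * γ t = ν ⊥ * γ ⊥ + ∑ t ∈ univ.erase ⊥, ν t * γ t :=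
    (Finset.add_sum_erase _ (fun t => ν t * γ t) (Finset.mem_univ _)).symm
  have sZ : ∑ t, ν t = ν ⊥ + ∑ t ∈ univ.erase ⊥, ν t := (Finset.add_sum_erase _ ν (Finset.mem_univ _)).symm
  set Z := ∑ t, ν t with hZdef
  have hZ0 : 0 ≤ Z := Finset.sum_nonneg fun t _ => hν t
  have hν0 := hν ⊥
  -- step 1: lower bounds for the `γ`-terms, summed
  have L1 : 0 ≤ ∑ t ∈ univ.erase ⊥, ((Z * ν t * (Z + ν ⊥) - T t) * (γ t - α t * β t) + T t * (γ t - γ ⊥)) := by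
    refine Finset.sum_nonneg fun t ht => ?_
    have ht' : t ≠ ⊥ := Finset.ne_of_mem_erase ht
    exact add_nonneg (mul_nonneg (sub_nonneg.2 (hT1 t ht')) (sub_nonneg.2 (hγf t ht')))
      (mul_nonneg (hT0 t ht') (sub_nonneg.2 (hγ0 t ht')))
  have eL1 : ∑ t ∈ univ.erase ⊥, ((Z * ν t * (Z + ν ⊥) - T t) * (γ t - α t * β t) + T t * (γ t - γ ⊥)) =
      Z * (Z + ν ⊥) * (∑ t ∈ univ.erase ⊥, ν t * γ t) - Z * (Z + ν ⊥) * (∑ t ∈ univ.erase ⊥, ν t * (α t * β t))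
        + ∑ t ∈ univ.erase ⊥, T t * (α t * β t) - γ ⊥ * ∑ t ∈ univ.erase ⊥, T t := by
    have e : ∀ t ∈ univ.erase (⊥ : P), (Z * ν t * (Z + ν ⊥) - T t) * (γ t - α t * β t) + T t * (γ t - γ ⊥) =
        Z * (Z + ν ⊥) * (ν t * γ t) - Z * (Z + ν ⊥) * (ν t * (α t * β t)) + T t * (α t * β t) - γ ⊥ * T t := by
      intro t _; ring
    rw [Finset.sum_congr rfl e, Finset.sum_sub_distrib, Finset.sum_add_distrib, Finset.sum_sub_distrib, ← Finset.mul_sum,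
      ← Finset.mul_sum, ← Finset.mul_sum]
  -- step 2: the increments `x = α − α ⊥`, `y = β − β ⊥`
  have hx0 : ∀ t, 0 ≤ α t - α ⊥ := fun t => sub_nonneg.2 (hα bot_le)
  have hxm : Monotone fun t => α t - α ⊥ := fun s t hst => sub_le_sub_right (hα hst) _
  have hy0 : ∀ t, 0 ≤ β t - β ⊥ := fun t => sub_nonneg.2 (hβ bot_le)
  have hym : Monotone fun t => β t - β ⊥ := fun s t hst => sub_le_sub_right (hβ hst) _
  have hQ := bform_nonneg (ν := ν) (T := T) (Z := Z) (c := Z + ν ⊥) hTii hx0 hxm (by simp) hy0 hym (by simp)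
  have hLx := lform_le (ν := ν) (T := T) (c := Z * ν ⊥) hTi hx0 hxm (by simp)
  have hLy := lform_le (ν := ν) (T := T) (c := Z * ν ⊥) hTi hy0 hym (by simp)
  -- conversions of the increment sums to atoms
  have c1 : ∑ t ∈ univ.erase ⊥, ν t * ((α t - α ⊥) * (β t - β ⊥)) = (∑ t ∈ univ.erase ⊥, ν t * (α t * β t))
      - β ⊥ * (∑ t ∈ univ.erase ⊥, ν t * α t) - α ⊥ * (∑ t ∈ univ.erase ⊥, ν t * β t) + α ⊥ * β ⊥ * ∑ t ∈ univ.erase ⊥, ν t := by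
    have e : ∀ t ∈ univ.erase (⊥ : P), ν t * ((α t - α ⊥) * (β t - β ⊥)) =
        ν t * (α t * β t) - β ⊥ * (ν t * α t) - α ⊥ * (ν t * β t) + α ⊥ * β ⊥ * ν t := by intro t _; ring
    rw [Finset.sum_congr rfl e, Finset.sum_add_distrib, Finset.sum_sub_distrib, Finset.sum_sub_distrib, ← Finset.mul_sum,
      ← Finset.mul_sum, ← Finset.mul_sum]
  have c2 : ∑ t ∈ univ.erase ⊥, ν t * (α t - α ⊥) = (∑ t ∈ univ.erase ⊥, ν t * α t) - α ⊥ * ∑ t ∈ univ.erase ⊥, ν t := by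
    have e : ∀ t ∈ univ.erase (⊥ : P), ν t * (α t - α ⊥) = ν t * α t - α ⊥ * ν t := by intro t _; ring
    rw [Finset.sum_congr rfl e, Finset.sum_sub_distrib, ← Finset.mul_sum]
  have c3 : ∑ t ∈ univ.erase ⊥, ν t * (β t - β ⊥) = (∑ t ∈ univ.erase ⊥, ν t * β t) - β ⊥ * ∑ t ∈ univ.erase ⊥, ν t := by
    have e : ∀ t ∈ univ.erase (⊥ : P), ν t * (β t - β ⊥) = ν t * β t - β ⊥ * ν t := by intro t _; ring
    rw [Finset.sum_congr rfl e, Finset.sum_sub_distrib, ← Finset.mul_sum]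
  have c4 : ∑ t ∈ univ.erase ⊥, T t * ((α t - α ⊥) * (β t - β ⊥)) = (∑ t ∈ univ.erase ⊥, T t * (α t * β t))
      - β ⊥ * (∑ t ∈ univ.erase ⊥, T t * α t) - α ⊥ * (∑ t ∈ univ.erase ⊥, T t * β t) + α ⊥ * β ⊥ * ∑ t ∈ univ.erase ⊥, T t := by
    have e : ∀ t ∈ univ.erase (⊥ : P), T t * ((α t - α ⊥) * (β t - β ⊥)) =
        T t * (α t * β t) - β ⊥ * (T t * α t) - α ⊥ * (T t * β t) + α ⊥ * β ⊥ * T t := by intro t _; ring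
    rw [Finset.sum_congr rfl e, Finset.sum_add_distrib, Finset.sum_sub_distrib, Finset.sum_sub_distrib, ← Finset.mul_sum,
      ← Finset.mul_sum, ← Finset.mul_sum]
  have c5 : ∑ t ∈ univ.erase ⊥, T t * (α t - α ⊥) = (∑ t ∈ univ.erase ⊥, T t * α t) - α ⊥ * ∑ t ∈ univ.erase ⊥, T t := by
    have e : ∀ t ∈ univ.erase (⊥ : P), T t * (α t - α ⊥) = T t * α t - α ⊥ * T t := by intro t _; ring
    rw [Finset.sum_congr rfl e, Finset.sum_sub_distrib, ← Finset.mul_sum]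
  have c6 : ∑ t ∈ univ.erase ⊥, T t * (β t - β ⊥) = (∑ t ∈ univ.erase ⊥, T t * β t) - β ⊥ * ∑ t ∈ univ.erase ⊥, T t := by
    have e : ∀ t ∈ univ.erase (⊥ : P), T t * (β t - β ⊥) = T t * β t - β ⊥ * T t := by intro t _; ring
    rw [Finset.sum_congr rfl e, Finset.sum_sub_distrib, ← Finset.mul_sum]
  rw [c1, c2, c3, c4] at hQ
  rw [c5, c2] at hLx
  rw [c6, c3] at hLy
  rw [eL1] at L1
  have hbr1 := mul_nonneg hα0 (sub_nonneg.2 hLy)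
  have hbr2 := mul_nonneg hβ0 (sub_nonneg.2 hLx)
  rw [sA, sB, sC]
  rw [hTsum] at L1 hQ hbr1 hbr2
  rw [sZ] at hQ L1 hbr1 hbr2 ⊢
  linarith [L1, hQ, hbr1, hbr2]

end Summit.CriticalPhenomena.PercolationContinuityZ3.Theorems.SahiE3SlotCertificate
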